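import Summits.ABC.IUTFork.Cor312HullReglue
import Summits.ABC.IUTFork.Cor312LogKummerRoute
import Summits.ABC.IUTFork.Cor312HullFrameReal
import HarnessLib

/-!
# [IUTchIII] Cor. 3.12 — the HULL-GLUED setting: print's `^{n,∘}𝒰` as THE Θ-region at every packet — same
# `−|log(Θ)|`, same typed Statement, `BridgeHyps` transported, and `hθ` at every label packet by construction

Record-only support piece of the abc-iut cell (seat abc-iut-w5-d060, WAVE-5; the GLOBAL form of
`Cor312HullReglue` (one packet) — together with p416677 `Cor312ThetaRegion3UnionNotAdm` this closes the bracket on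
the census item «`BridgeHyps.image_adm` is STRONGER THAN PRINT» (abc-iut-w5-d155 on p416677)). TAKES NO SIDE on
[IUTchIII] Cor. 3.12. ONE bookkeeping `def` (`Setting.hullGlued`, a field re-assignment of the frozen
`Cor312.Setting`; no `Prop`, nothing hypothesised), theorems otherwise; no `Prop` fact.

For a setting `P` let `P♮ := P.hullGlued` be `P` with its Θ-glue `thetaRegionOf` replaced, at EVERY packet
`(j, v_ℚ)` and every lattice position `m`, by print's own object `^{n,∘}𝒰_{j,v_ℚ} = P.thetaHull j vQ` — "the
holomorphic hull of the union of the possible images of a Θ-pilot object" ([IUTchIII] Cor. 3.12 p. 173 l. 46 –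
p. 174 l. 4; proof p. 174 l. 50 – p. 175 l. 1); every other field (column, frames, `q`-side, lattice, Prop. 3.7
signature) is `P`'s. Then, wherever the indeterminacies (Ind1),(Ind2) act by hull-frame automorphisms (`hHul`:
they map hull-sets `λ·𝒪_L` to hull-sets — capsule permutations, `{±1}`, unit isometries do) and hull-sets admit
hulls (`hHas`):

* `hullGlued_possibleImages`, `hullGlued_thetaHull` — the possible images of `P♮` at `(j, v_ℚ)` are `{^{n,∘}𝒰}`
  (the hull is (Ind1),(Ind2)-stable, `Cor312HullReglue`), and the packet hull of `P♮` is `P`'s (`hull ∘ hull =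
  hull`, NO non-degeneracy hypothesis);
* `hullGlued_thetaLocal_of` / `hullGlued_thetaFinite_of` / `hullGlued_negLogTheta_of` / **`hullGlued_statement_of`**
  — if `P.HullDefined` (resp. `P.ThetaFinite`, resp. `P.Statement`) then `P♮` has the same local Θ-volume
  (resp. is Θ-finite with the SAME `−|log(Θ)|`, resp. satisfies the typed Statement); with the descent property
  `hdeg` ("a bounded set whose hull admits a hull admits a hull" — true for the real frames, where admitting a hull
  = non-degeneracy) these become `iff`s: `hullGlued_hullDefined_iff`, `hullGlued_thetaLocal`,
  `hullGlued_thetaFinite_iff`, `hullGlued_negLogTheta`, **`hullGlued_statement_iff`**, `hullGlued_cThetaForm_iff`;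
* **`adm_thetaRegion3_hullGlued`**, **`thetaRegionsAdm_hullGlued`** — the (Ind3)-region of `P♮` at a packet with
  `P.HullDefined` IS the hull-set `^{n,∘}𝒰`, hence ADMISSIBLE (`hul_adm`): the residual `hθ` of abc-iut-c312-5's
  `bridgeHyps_of_summands` / `Real.bridgeHyps_DH` and abc-iut-c312-11's `ThetaRegionsAdm` hold for `P♮` BY
  CONSTRUCTION (no `hHul` needed);
* **`Cor312Vol.bridgeHyps_hullGlued : BridgeHyps P → BridgeHyps P♮`** and the summary
  `Cor312Vol.hullGlued_summary`.

Reading (neutral): over the typed route, the `m`-variation of the Θ-Kummer images ((Ind3) at region level, which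
`BridgeHyps.image_adm` cannot host when two images are coordinate-separated — p416677) can ALWAYS be traded for
print's hull at every packet without changing `−|log(q)|`, `−|log(Θ)|` or the adjudicated Statement, landing in a
setting that satisfies the typed premise set with `hθ`/`ThetaRegionsAdm` for free. So the stronger-than-print
feature is immaterial to the adjudication; what decides the Statement is the GLUE `P.thetaHull` itself, i.e. the
pinned region of the PINNED-REGIONS round (ADJUDICATION-SPEC v2.3 (pΘ)). Hypotheses `hHul`/`hHas`/`hdeg` are
EXPLICIT; §5 DISCHARGES `hHas`/`hdeg` at the real hull frames (`HullFrame.ofLocalFields` and its pull-backs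
`comap e` along a surjective comparison); `hHul` (indeterminacy-specific) is discharged for no instance here.
Nothing of [IUTchIII] asserted.
[claim: Mochizuki2012, status: disputed] for the Corollary's vocabulary only.
-/

noncomputable section

open Set

namespace Summit.ABC.IUTFork.Cor312

namespace Setting

open Thm311 Literature.IUT.LogThetaLattice

variable {T : ThetaIndex} {S : Situation T} (P : Setting S)

/-! ## 1. The hull-glued setting -/

/-- **`P♮`, the HULL-GLUED setting**: `P` with the region attached to every object of `†𝒞^⊩_lgp` at every lattice
position and every packet `(j, v_ℚ)` replaced by print's `^{n,∘}𝒰_{j,v_ℚ} = P.thetaHull j vQ` (Cor. 3.12 p. 173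
l. 46 – p. 174 l. 4); all other fields are `P`'s. Bookkeeping only. [claim: Mochizuki2012, status: disputed] -/
def hullGlued : Setting S :=
  { P with thetaRegionOf := fun _ _ j vQ => P.thetaHull j vQ }

/-- `−|log(q)|` is unchanged. [folklore] -/
theorem hullGlued_negLogQ : P.hullGlued.negLogQ = P.negLogQ := rfl

/-- "`|log(q)| > 0`" is unchanged. [folklore] -/
theorem hullGlued_absLogQPos_iff : P.hullGlued.AbsLogQPos ↔ P.AbsLogQPos := Iff.rfl

/-- Every Θ-Kummer image of `P♮` at `(j, v_ℚ)` is `^{n,∘}𝒰_{j,v_ℚ}` (`m`-constant). [folklore] -/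
theorem hullGlued_thetaRegion (m : ℤ) (j : T.Label) (vQ : T.VQ) :
    P.hullGlued.thetaRegion m j vQ = P.thetaHull j vQ := rfl

/-- The (Ind3)-region of `P♮` at `(j, v_ℚ)` is `^{n,∘}𝒰_{j,v_ℚ}`. [folklore] -/
theorem hullGlued_thetaRegion3 (j : T.Label) (vQ : T.VQ) :
    P.hullGlued.thetaRegion3 j vQ = P.thetaHull j vQ := by
  show (⋃ m : ℤ, P.hullGlued.thetaRegion m j vQ) = _
  simp_rw [hullGlued_thetaRegion]
  exact Set.iUnion_const _

/-- **`hθ` BY CONSTRUCTION**: wherever `P`'s packet hull is defined, the (Ind3)-region of `P♮` is the hull-set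
`^{n,∘}𝒰` and hence admissible (`hul_adm`) — no hypothesis on the indeterminacies. Contrast p416677
`not_adm_thetaRegion3_of_separated`. [claim: Mochizuki2012, status: disputed] -/
theorem adm_thetaRegion3_hullGlued {j : T.Label} {vQ : T.VQ} (hdef : P.HullDefined j vQ) :
    (S.D P.n).Adm j vQ (P.hullGlued.thetaRegion3 j vQ) := by
  rw [P.hullGlued_thetaRegion3]
  exact P.thetaHull_adm hdef

/-- The single images of `P♮` are admissible likewise (each IS `^{n,∘}𝒰`). [claim: Mochizuki2012, status: disputed] -/
theorem adm_thetaRegion_hullGlued {j : T.Label} {vQ : T.VQ} (hdef : P.HullDefined j vQ) (m : ℤ) :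
    (S.D P.n).Adm j vQ (P.hullGlued.thetaRegion m j vQ) :=
  P.thetaHull_adm hdef

/-! ## 2. At one packet, under hull-frame-automorphic indeterminacies -/

section AtPacket

variable {j : T.Label} {vQ : T.VQ}
  (hHul : ∀ Φ ∈ indGroup S, ∀ H ∈ (P.frame j vQ).Hul, Φ j vQ '' H ∈ (P.frame j vQ).Hul)

include hHul

/-- The possible images of `P♮` at `(j, v_ℚ)` are exactly `{^{n,∘}𝒰_{j,v_ℚ}}` (the hull is (Ind1),(Ind2)-stable,
`Setting.image_thetaHull_eq_of_mapsHul`). [claim: Mochizuki2012, status: disputed] -/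
theorem hullGlued_possibleImages : P.hullGlued.possibleImages j vQ = {P.thetaHull j vQ} := by
  ext U
  simp only [possibleImages, hullGlued_thetaRegion3, Set.mem_setOf_eq, Set.mem_singleton_iff]
  constructor
  · rintro ⟨Φ, hΦ, rfl⟩
    exact P.image_thetaHull_eq_of_mapsHul hHul hΦ
  · rintro rfl
    exact ⟨1, (indGroup S).one_mem, by simp⟩

/-- **The packet hull of `P♮` is `P`'s**: `hull(^{n,∘}𝒰) = ^{n,∘}𝒰` since the hull is idempotent — no
non-degeneracy hypothesis. [claim: Mochizuki2012, status: disputed] -/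
theorem hullGlued_thetaHull : P.hullGlued.thetaHull j vQ = P.thetaHull j vQ := by
  show (P.frame j vQ).hull (⋃₀ P.hullGlued.possibleImages j vQ) = _
  rw [P.hullGlued_possibleImages hHul, Set.sUnion_singleton]
  exact (P.frame j vQ).hull_hull _

/-- `HullDefined` passes from `P` to `P♮` when hull-sets admit hulls. [claim: Mochizuki2012, status: disputed] -/
theorem hullGlued_hullDefined_of (hHas : ∀ H ∈ (P.frame j vQ).Hul, (P.frame j vQ).HasHull H)
    (hdef : P.HullDefined j vQ) : P.hullGlued.HullDefined j vQ := by
  show (P.frame j vQ).IsBounded (⋃₀ P.hullGlued.possibleImages j vQ) ∧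
    (P.frame j vQ).HasHull (⋃₀ P.hullGlued.possibleImages j vQ)
  rw [P.hullGlued_possibleImages hHul, Set.sUnion_singleton]
  exact ⟨(P.frame j vQ).hull_bounded hdef.1,
    hHas _ ((P.frame j vQ).hull_mem_of_hasHull hdef.1 hdef.2)⟩

/-- … and back when non-degeneracy DESCENDS from the hull (`hdeg`: a bounded set whose hull admits a hull admits a
hull — at the real frames "admits a hull" is non-degeneracy, which the hull of a degenerate bounded set fails too).
[claim: Mochizuki2012, status: disputed] -/
theorem hullGlued_hullDefined_iff (hHas : ∀ H ∈ (P.frame j vQ).Hul, (P.frame j vQ).HasHull H)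
    (hdeg : ∀ U : Set (S.L.Packet j vQ), (P.frame j vQ).IsBounded U →
      (P.frame j vQ).HasHull ((P.frame j vQ).hull U) → (P.frame j vQ).HasHull U) :
    P.hullGlued.HullDefined j vQ ↔ P.HullDefined j vQ := by
  refine ⟨fun h => ?_, P.hullGlued_hullDefined_of hHul hHas⟩
  have h' : (P.frame j vQ).IsBounded (P.thetaHull j vQ) ∧ (P.frame j vQ).HasHull (P.thetaHull j vQ) := by
    have h0 : (P.frame j vQ).IsBounded (⋃₀ P.hullGlued.possibleImages j vQ) ∧
        (P.frame j vQ).HasHull (⋃₀ P.hullGlued.possibleImages j vQ) := h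
    rwa [P.hullGlued_possibleImages hHul, Set.sUnion_singleton] at h0
  have hb : (P.frame j vQ).IsBounded (⋃₀ P.possibleImages j vQ) :=
    (P.frame j vQ).bounded_mono _ _ ((P.frame j vQ).subset_hull _) h'.1
  exact ⟨hb, hdeg _ hb h'.2⟩

/-- **The local Θ-volume is unchanged** where `P`'s packet hull is defined. [claim: Mochizuki2012, status: disputed] -/
theorem hullGlued_thetaLocal_of (hHas : ∀ H ∈ (P.frame j vQ).Hul, (P.frame j vQ).HasHull H)
    (hdef : P.HullDefined j vQ) : P.hullGlued.thetaLocal j vQ = P.thetaLocal j vQ := by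
  unfold thetaLocal
  rw [if_pos (P.hullGlued_hullDefined_of hHul hHas hdef), if_pos hdef, P.hullGlued_thetaHull hHul]
  rfl

/-- The local Θ-volume is unchanged outright under the descent property. [claim: Mochizuki2012, status: disputed] -/
theorem hullGlued_thetaLocal (hHas : ∀ H ∈ (P.frame j vQ).Hul, (P.frame j vQ).HasHull H)
    (hdeg : ∀ U : Set (S.L.Packet j vQ), (P.frame j vQ).IsBounded U →
      (P.frame j vQ).HasHull ((P.frame j vQ).hull U) → (P.frame j vQ).HasHull U) :
    P.hullGlued.thetaLocal j vQ = P.thetaLocal j vQ := by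
  by_cases hdef : P.HullDefined j vQ
  · exact P.hullGlued_thetaLocal_of hHul hHas hdef
  · unfold thetaLocal
    rw [if_neg hdef, if_neg fun h => hdef ((P.hullGlued_hullDefined_iff hHul hHas hdeg).1 h)]

end AtPacket

/-! ## 3. Globally: `ThetaFinite`, `−|log(Θ)|`, the Statement -/

section Global

variable
  (hHul : ∀ (i : Fin T.lstar) (vQ : T.VQ), ∀ Φ ∈ indGroup S, ∀ H ∈ (P.frame (labelSucc i) vQ).Hul,
    Φ (labelSucc i) vQ '' H ∈ (P.frame (labelSucc i) vQ).Hul)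
  (hHas : ∀ (i : Fin T.lstar) (vQ : T.VQ), ∀ H ∈ (P.frame (labelSucc i) vQ).Hul,
    (P.frame (labelSucc i) vQ).HasHull H)

include hHul hHas

/-- **`ThetaFinite` passes to `P♮`** with the same local volumes. [claim: Mochizuki2012, status: disputed] -/
theorem hullGlued_thetaFinite_of (hfin : P.ThetaFinite) : P.hullGlued.ThetaFinite := by
  -- under `ThetaFinite` every label packet hull is defined (abc-iut-c312-1's `hullDefined_of_thetaFinite`,
  -- stated there over a `LatticeSituation`; two lines here over a general `Situation`)
  have hdef : ∀ (i : Fin T.lstar) (vQ : T.VQ), P.HullDefined (labelSucc i) vQ := fun i vQ => by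
    by_contra h
    exact hfin.1 i vQ (by unfold thetaLocal; rw [if_neg h])
  have hloc : ∀ (i : Fin T.lstar) (vQ : T.VQ),
      P.hullGlued.thetaLocal (labelSucc i) vQ = P.thetaLocal (labelSucc i) vQ := fun i vQ =>
    P.hullGlued_thetaLocal_of (hHul i vQ) (hHas i vQ) (hdef i vQ)
  refine ⟨fun i vQ => ?_, fun i => ?_⟩
  · rw [hloc]; exact hfin.1 i vQ
  · simp_rw [hloc]; exact hfin.2 i

/-- **`−|log(Θ)|` is unchanged** when `P` is Θ-finite. [claim: Mochizuki2012, status: disputed] -/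
theorem hullGlued_negLogTheta_of (hfin : P.ThetaFinite) : P.hullGlued.negLogTheta = P.negLogTheta := by
  have hdef : ∀ (i : Fin T.lstar) (vQ : T.VQ), P.HullDefined (labelSucc i) vQ := fun i vQ => by
    by_contra h
    exact hfin.1 i vQ (by unfold thetaLocal; rw [if_neg h])
  have hloc : ∀ (i : Fin T.lstar) (vQ : T.VQ),
      P.hullGlued.thetaLocal (labelSucc i) vQ = P.thetaLocal (labelSucc i) vQ := fun i vQ =>
    P.hullGlued_thetaLocal_of (hHul i vQ) (hHas i vQ) (hdef i vQ)
  unfold negLogTheta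
  rw [if_pos hfin, if_pos (P.hullGlued_thetaFinite_of hHul hHas hfin)]
  simp_rw [hloc]

/-- **The typed Statement passes from `P` to `P♮`.** [claim: Mochizuki2012, status: disputed] -/
theorem hullGlued_statement_of (h : P.Statement) : P.hullGlued.Statement := by
  have hfin : P.ThetaFinite := by
    by_contra hf
    exact h.1 (by unfold negLogTheta; rw [if_neg hf])
  unfold Statement
  rw [P.hullGlued_negLogTheta_of hHul hHas hfin]
  exact h

variable
  (hdeg : ∀ (i : Fin T.lstar) (vQ : T.VQ) (U : Set (S.L.Packet (labelSucc i) vQ)),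
    (P.frame (labelSucc i) vQ).IsBounded U →
      (P.frame (labelSucc i) vQ).HasHull ((P.frame (labelSucc i) vQ).hull U) →
        (P.frame (labelSucc i) vQ).HasHull U)

include hdeg

/-- `ThetaFinite` is EQUIVALENT for `P` and `P♮` under the descent property. [claim: Mochizuki2012, status: disputed] -/
theorem hullGlued_thetaFinite_iff : P.hullGlued.ThetaFinite ↔ P.ThetaFinite := by
  unfold ThetaFinite
  simp_rw [fun i vQ => P.hullGlued_thetaLocal (hHul i vQ) (hHas i vQ) (hdeg i vQ)]

/-- **`−|log(Θ)|` is EQUAL for `P` and `P♮`** under the descent property. [claim: Mochizuki2012, status: disputed] -/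
theorem hullGlued_negLogTheta : P.hullGlued.negLogTheta = P.negLogTheta := by
  have hloc := fun i vQ => P.hullGlued_thetaLocal (hHul i vQ) (hHas i vQ) (hdeg i vQ)
  have hfin := P.hullGlued_thetaFinite_iff hHul hHas hdeg
  unfold negLogTheta
  by_cases hf : P.ThetaFinite
  · rw [if_pos hf, if_pos (hfin.2 hf)]
    simp_rw [hloc]
  · rw [if_neg hf, if_neg fun h => hf (hfin.1 h)]

/-- **The typed Statement of Cor. 3.12 is EQUIVALENT for `P` and its hull-glued `P♮`.**
[claim: Mochizuki2012, status: disputed] -/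
theorem hullGlued_statement_iff : P.hullGlued.Statement ↔ P.Statement := by
  unfold Statement
  rw [P.hullGlued_negLogTheta hHul hHas hdeg, P.hullGlued_negLogQ]

/-- The `C_Θ`-form is equivalent likewise. [claim: Mochizuki2012, status: disputed] -/
theorem hullGlued_cThetaForm_iff : P.hullGlued.CThetaForm ↔ P.CThetaForm := by
  unfold CThetaForm absLogQ
  rw [P.hullGlued_negLogTheta hHul hHas hdeg, P.hullGlued_negLogQ]

end Global

end Setting

end Summit.ABC.IUTFork.Cor312

/-! ## 4. `BridgeHyps` and `ThetaRegionsAdm` for the hull-glued setting -/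

namespace Summit.ABC.IUTFork.Cor312Vol

open Thm311 Cor312 Cor312.Setting Literature.IUT.LogThetaLattice

variable {T : ThetaIndex} {S : Situation T} {P : Cor312.Setting S}

/-- **`ThetaRegionsAdm` (abc-iut-c312-11, Thm. 3.11 (ii) (a) "each Kummer image admissible") holds for `P♮`**
whenever `P`'s label packet hulls are defined (e.g. under `P.ThetaFinite` / `BridgeHyps P`): each image IS
`^{n,∘}𝒰`. [claim: Mochizuki2012, status: disputed] -/
theorem thetaRegionsAdm_hullGlued (hdef : ∀ (i : Fin T.lstar) (vQ : T.VQ), P.HullDefined (labelSucc i) vQ) :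
    ThetaRegionsAdm P.hullGlued :=
  fun m i vQ => P.adm_thetaRegion_hullGlued (hdef i vQ) m

/-- **`BridgeHyps` is TRANSPORTED to the hull-glued setting** (hull-frame-automorphic indeterminacies and
hull-sets admitting hulls at the label packets): `mono`/`hul_nonempty` are about the untouched container and
frames; the one possible image `^{n,∘}𝒰` per packet is an admissible hull-set (`HullDefined` from `ThetaFinite`);
finite support of global image choices is the finite support of `P`'s local Θ-volumes; `^{n,∘}𝒰 ⊇` the nonempty
(Ind3)-region; `ThetaFinite` by `hullGlued_thetaFinite_of`. [claim: Mochizuki2012, status: disputed] -/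
theorem bridgeHyps_hullGlued (H : BridgeHyps P)
    (hHul : ∀ (i : Fin T.lstar) (vQ : T.VQ), ∀ Φ ∈ indGroup S, ∀ H ∈ (P.frame (labelSucc i) vQ).Hul,
      Φ (labelSucc i) vQ '' H ∈ (P.frame (labelSucc i) vQ).Hul)
    (hHas : ∀ (i : Fin T.lstar) (vQ : T.VQ), ∀ H ∈ (P.frame (labelSucc i) vQ).Hul,
      (P.frame (labelSucc i) vQ).HasHull H) :
    BridgeHyps P.hullGlued where
  mono := H.mono
  image_adm i vQ U hU := by
    rw [P.hullGlued_possibleImages (hHul i vQ), Set.mem_singleton_iff] at hU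
    rw [hU]
    exact P.thetaHull_adm (hullDefined_of_finite H i vQ)
  image_fin U := by
    have hU : ∀ t : Fin T.lstar × T.VQ, U.1 t = P.thetaHull (labelSucc t.1) t.2 := fun t => by
      have h := U.2 t
      rw [P.hullGlued_possibleImages (hHul t.1 t.2), Set.mem_singleton_iff] at h
      exact h
    have hbig : (⋃ i : Fin T.lstar, (fun vQ : T.VQ => (i, vQ)) '' Function.support fun vQ : T.VQ =>
        (P.thetaLocal (labelSucc i) vQ).untopD 0).Finite :=
      Set.finite_iUnion fun i => (H.finite.2 i).image _
    refine hbig.subset fun t ht => ?_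
    simp only [Function.mem_support, ne_eq, mul_eq_zero, not_or] at ht
    refine Set.mem_iUnion.2 ⟨t.1, ⟨t.2, ?_, rfl⟩⟩
    rw [Function.mem_support, thetaLocal_untopD H t.1 t.2, ← hU t]
    exact ht.2
  hul_nonempty := H.hul_nonempty
  theta_nonempty i vQ := by
    rw [P.hullGlued_thetaRegion3]
    exact thetaHull_nonempty H (i, vQ)
  finite := P.hullGlued_thetaFinite_of hHul hHas H.finite

/-- **Summary.** From `BridgeHyps P` (with hull-frame-automorphic indeterminacies and hull-sets admitting hulls at
the label packets): the hull-glued `P♮` satisfies `BridgeHyps`, `ThetaRegionsAdm`, has `hθ` at every label packet,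
the same `|log(q)| > 0` clause and the SAME `−|log(Θ)|`; its typed Statement FOLLOWS from `P`'s (and is
EQUIVALENT to it under the descent property, `hullGlued_statement_iff`). [claim: Mochizuki2012, status: disputed] -/
theorem hullGlued_summary (H : BridgeHyps P)
    (hHul : ∀ (i : Fin T.lstar) (vQ : T.VQ), ∀ Φ ∈ indGroup S, ∀ H ∈ (P.frame (labelSucc i) vQ).Hul,
      Φ (labelSucc i) vQ '' H ∈ (P.frame (labelSucc i) vQ).Hul)
    (hHas : ∀ (i : Fin T.lstar) (vQ : T.VQ), ∀ H ∈ (P.frame (labelSucc i) vQ).Hul,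
      (P.frame (labelSucc i) vQ).HasHull H) :
    BridgeHyps P.hullGlued ∧ ThetaRegionsAdm P.hullGlued ∧
      (∀ (i : Fin T.lstar) (vQ : T.VQ), (S.D P.n).Adm _ vQ (P.hullGlued.thetaRegion3 (labelSucc i) vQ)) ∧
      (P.hullGlued.AbsLogQPos ↔ P.AbsLogQPos) ∧ P.hullGlued.negLogTheta = P.negLogTheta ∧
      (P.Statement → P.hullGlued.Statement) :=
  ⟨bridgeHyps_hullGlued H hHul hHas,
    thetaRegionsAdm_hullGlued fun i vQ => hullDefined_of_finite H i vQ,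
    fun i vQ => P.adm_thetaRegion3_hullGlued (hullDefined_of_finite H i vQ),
    P.hullGlued_absLogQPos_iff, P.hullGlued_negLogTheta_of hHul hHas H.finite,
    P.hullGlued_statement_of hHul hHas⟩

end Summit.ABC.IUTFork.Cor312Vol


/-! ## 5. The two frame hypotheses HOLD at the real hull frames (campaign S / c312-7 `HullFrame.ofLocalFields`,
pulled back along a surjective comparison) -/

namespace Summit.ABC.IUTFork.Cor312.HullFrame

open Literature.IUT.LogVolume

variable {J : Type} [Fintype J] (K : J → Type) [∀ j, NontriviallyNormedField (K j)]
  [∀ j, IsUltrametricDist (K j)] [∀ j, ProperSpace (K j)]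

/-- At the real frame, HULL-SETS ADMIT HULLS (`hHas`): a hull-set `λ·𝒪_L` is non-degenerate (it contains `λ`).
[folklore] -/
theorem ofLocalFields_hasHull_of_mem {H : Set (Π j, K j)} (hH : H ∈ (ofLocalFields K).Hul) :
    (ofLocalFields K).HasHull H :=
  IsHullSet.isNondegenerate K hH

/-- At the real frame, NON-DEGENERACY DESCENDS FROM THE HULL (`hdeg`): if a bounded `U` lies in the coordinate
hyperplane `x_j = 0`, so does its hull — polydiscs containing `U` may have arbitrarily small nonzero `j`-th
radius. [folklore] -/
theorem ofLocalFields_hasHull_of_hasHull_hull {U : Set (Π j, K j)} (hU : (ofLocalFields K).IsBounded U)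
    (h : (ofLocalFields K).HasHull ((ofLocalFields K).hull U)) : (ofLocalFields K).HasHull U := by
  intro j
  by_contra hj
  push Not at hj
  obtain ⟨x, hx, hxj⟩ := h j
  obtain ⟨H₀, ⟨c₀, hc₀, rfl⟩, hU₀⟩ := (ofLocalFields K).exists_hul U hU
  obtain ⟨t, ht0, htx⟩ := NormedField.exists_norm_lt (K j) (norm_pos_iff.mpr hxj)
  have ht : t ≠ 0 := norm_pos_iff.mp ht0
  classical
  set c : Π i, K i := Function.update c₀ j t with hc
  have hcne : ∀ i, c i ≠ 0 := fun i => by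
    by_cases hi : i = j
    · subst hi; rw [hc, Function.update_self]; exact ht
    · rw [hc, Function.update_of_ne hi]; exact hc₀ i
  have hUc : U ⊆ hullSet K c := fun u hu => (mem_polydisc K).mpr fun i => by
    by_cases hi : i = j
    · subst hi
      rw [hj u hu, norm_zero, hc, Function.update_self]
      exact norm_nonneg _
    · rw [hc, Function.update_of_ne hi]
      exact (mem_polydisc K).mp (hU₀ hu) i
  have hxc : x ∈ hullSet K c := (ofLocalFields K).hull_subset_of_mem ⟨c, hcne, rfl⟩ hUc hx
  have hle : ‖x j‖ ≤ ‖c j‖ := (mem_polydisc K).mp hxc j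
  rw [hc, Function.update_self] at hle
  exact absurd (lt_of_le_of_lt hle htx) (lt_irrefl _)

/-- Both frame hypotheses at the frame PULLED BACK along a surjective comparison `e` (c312-7's
`HullFrame.comap`, the shape of `HullFrame.ofComparison`): hull-sets admit hulls … [folklore] -/
theorem comap_ofLocalFields_hasHull_of_mem {X : Type} {e : X → Π j, K j} (he : Function.Surjective e)
    {H : Set X} (hH : H ∈ ((ofLocalFields K).comap e).Hul) : ((ofLocalFields K).comap e).HasHull H := by
  obtain ⟨H', hH', rfl⟩ := hH
  show (ofLocalFields K).HasHull (e '' (e ⁻¹' H'))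
  rw [Set.image_preimage_eq H' he]
  exact ofLocalFields_hasHull_of_mem K hH'

/-- … and non-degeneracy descends from the hull. [folklore] -/
theorem comap_ofLocalFields_hasHull_of_hasHull_hull {X : Type} {e : X → Π j, K j}
    (he : Function.Surjective e) {U : Set X} (hU : ((ofLocalFields K).comap e).IsBounded U)
    (h : ((ofLocalFields K).comap e).HasHull (((ofLocalFields K).comap e).hull U)) :
    ((ofLocalFields K).comap e).HasHull U := by
  have hb : (ofLocalFields K).IsBounded (e '' U) := hU
  have h' : (ofLocalFields K).HasHull (e '' (((ofLocalFields K).comap e).hull U)) := h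
  rw [comap_hull e (ofLocalFields K) hb, Set.image_preimage_eq _ he] at h'
  exact ofLocalFields_hasHull_of_hasHull_hull K hb h'

end Summit.ABC.IUTFork.Cor312.HullFrame

end
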